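import Mathlib
import HarnessLib
import Summits.Langlands.Statement
import Literature.NumberTheory.GaloisRepresentations.LabelledHodgeTateWeights
import Literature.NumberTheory.PAdicHodge.FontaineDpst
import Summits.Langlands.Langlands.Theses.WeightMultiplicitySplit
import Summits.Langlands.Langlands.Theorems.WeightMultiplicitySplitWallWeightReciprocityOfSplit

set_option linter.dupNamespace false

/-!
# WeightMultiplicitySplitMinusculeHodgeType — the MINUSCULE-HODGE-TYPE VOCABULARY AND KERNELS of route `WeightMultiplicitySplit` at W_Prim
(statement-and-kernel support module; `--supports stmt-Langlands-33605`)

TREE TWIN of the decomp-langlands lens-2 gen-11 node `nodes/lens-2-g11-MinusculeHodgeTypeSplit.lean` (namespace swap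
`Theses.MinusculeHodgeTypeSplit` ↦ `Theorems.WeightMultiplicitySplitMinusculeHodgeType`, `import HarnessLib.Audit` dropped, the 20 host-route references `WeightMultiplicitySplit.…` written fully qualified; nothing else changed):
`def … : Prop` predicates with the Galois representation as argument (no axiom, no instance, no notation), the four CELL statements + FRAME of the
child route `MinusculeHodgeTypeSplit` as named `def`s (so its items can be cited / bridged BY NAME), `Iff.rfl` bridges against the TREE decl
`WeightMultiplicitySplit.WallLieIrreducibleAutomorphy`, and the complete-proof kernels (exactness of the split, necessity from `Langlands`, the frame
from the host items and the landed glue, the deciding theorem).  No new mathematics is asserted; 0 sorry; axioms the standard three.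

## Node record (verbatim)

NODE TARGET (never re-typed; text of record = the tree's `Theses/Summit.Langlands.Langlands.Theses.WeightMultiplicitySplit.lean` rev 2, imported, used BY NAME):
* W_Prim = `WeightMultiplicitySplit.WallLieIrreducibleAutomorphy` (stmt-Langlands-33605, crux r204, OPEN, LAYER-2 child of W = `WallWeightReciprocity`
  24354 by the g10 split, DECLARED RESIDUAL of the wall chamber): GIVEN multiplicity-≤-2 reciprocity below rank n (`MultTwoReciprocityBelow n`),
  direction (B) «Galois ⟹ automorphic» for the irreducible pinned-geometric ρ : Γ_F → GL_n(ℚ̄_ℓ) of WALL Hodge–Tate type (some labelled weight of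
  multiplicity 2, none of multiplicity ≥ 3) with PRIMITIVE INFINITE monodromy (Lie-irreducible, not potentially scalar) — every number field F, every n,
  every datum, every level, every ℓ, ι.

THE CUT = the MINUSCULE / NON-MINUSCULE dichotomy of the Hodge–Tate cocharacter of the bound ρ (Deligne's axiom (SV1) read on GL_n):
    `IsHTMinuscule ρ` :⟺ at every place v ∣ ℓ and every label τ : F_v → ℚ̄_ℓ the labelled Hodge–Tate weights lie in {a_τ, a_τ + 1} for some a_τ ∈ ℤ
    (⟺ ad ∘ μ_HT,τ has weights in {−1, 0, 1} ⟺ μ_HT,τ is minuscule modulo the centre ⟺ the τ-Hodge structure is of Shimura / weight-one type: its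
    period domain is Hermitian symmetric with NO Griffiths-transversality constraint, i.e. it varies freely in an abelian-scheme-type family).
  A wall-type minuscule multiset is {a,a}, {a,a,a+1} / {a,a+1,a+1} or {a,a,a+1,a+1}: on paper the minuscule wall world is EXACTLY the three classical
  low-rank PEL pictures — weight-one type (GL₂), Picard type (U(2,1)), abelian-surface type (GSp₄ / U(2,2)) — and nothing of rank ≥ 5
  (`card_le_four_of_minuscule_wall`; the tree does not know `card HT_τ = n`, so the rank clause is carried EXPLICITLY and the phantom «minuscule ∧ n ≥ 5»
  is folded into the residual, which is therefore typed as «¬ (minuscule ∧ n ≤ 4)»).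
  Cells (each = W_Prim's text VERBATIM with ONE extra conjunct on the bound ρ / the rank; all keep the IH antecedent):
    MIN2 `MinusculeWallRankTwoAutomorphy`   — minuscule ∧ n ≤ 2 : weight-one Hodge type with infinite primitive monodromy («vanishing in disguise»:
                                               EMPTY by Sen + weight-one finiteness theorems on the odd totally-real sector; dark elsewhere)
    MIN3 `MinusculeWallRankThreeAutomorphy` — minuscule ∧ n = 3 : Picard / U(2,1) type {a,a,a+1}
    MIN4 `MinusculeWallRankFourAutomorphy`  — minuscule ∧ n = 4 : abelian-surface type {a,a,a+1,a+1} (BCGP 2021 potential automorphy, BCGP 2025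
                                               modularity: the ONLY irregular Hodge type with a (potential) automorphy ENGINE in print) — ATTACKED CONJUNCT
    R    `NonMinusculeWallAutomorphy`       — ¬ (minuscule ∧ n ≤ 4) : Hodge length ≥ 2 at some label (partial weight one, (k,2)-Siegel type k ≥ 3,
                                               non-minuscule U(2,1), every wall type of rank ≥ 5) — Griffiths-rigid, no moduli, no Moret-Bailly:
                                               DECLARED RESIDUAL
  FRAME `WallLieIrreducibleFrame` := W_Prim → Langlands (support; content = the HOST ROUTE below W_Prim, certified here from the host's `closes`, the
  LANDED glue `Theorems.WeightMultiplicitySplit_WallWeightReciprocity_of_split_proof` and the host items G, W_A, W_Fin, W_Str, D BY NAME: `frame_of_host`).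

KERNEL (all mod NOTHING):  W_Prim ⟺ MIN2 ∧ MIN3 ∧ MIN4 ∧ R (`wallLieIrreducible_iff_cells`, excluded middle on the inlined dial + `omega` on n) ·
each cell ⟸ W_Prim ⟸ Langlands (`…_of_wallLieIrreducible`, `…_of_langlands`) · Langlands ⟺ (MIN2 ∧ MIN3 ∧ MIN4 ∧ R) ∧ FRAME (`langlands_iff_pieces`) ·
`closes : MIN2 → MIN3 → MIN4 → R → FRAME → Langlands` (= the child route's deciding theorem, `childroute.glue.lean` VERBATIM) ·
`frame_of_host : G → W_A → W_Fin → W_Str → D → FRAME`, `frame_of_langlands`.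
The dial depends on ρ only through its labelled Hodge–Tate multisets, hence is invariant under algebraic twists (shift a_τ), duals (a ↦ −a−1),
restriction to any finite extension (labels pull back) and change of (ℓ, ι) inside a compatible system (HT multisets are independent of λ): ORBIT-CLOSED
under the (B)-transport groupoid; rank-changing print moves (⊗, Ind, Sym, As) land in lower rank = inside the IH or in the sibling cells W_Str / W_Fin.
See the memo `MinusculeHodgeTypeSplit.md` for tags, booked print loci, barrier placement and the census.
-/

namespace Summit.Langlands.Langlands.Theorems.WeightMultiplicitySplitMinusculeHodgeType

open scoped BigOperators Classical Matrix

/-! ## 1. Vocabulary (structured forms; the ITEMS below are the inlined one-liners, tied to these by `Iff.rfl`) -/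

section Vocabulary

variable {F : Type} [Field F] [NumberField F] {n : ℕ} {ℓ : ℕ} [Fact ℓ.Prime]

/-- labelled Hodge–Tate weight multiplicity ≤ k for Fontaine's PINNED datum (g0/g10 `HodgeTateMultLE` VERBATIM). [cite: CalegariGeraghty2017, §1] -/
def HodgeTateMultLE (k : ℕ) (ρ : Literature.NumberTheory.GaloisRepresentations.FramedGaloisRep F (PadicAlgCl ℓ) n) : Prop :=
  ∀ (v : IsDedekindDomain.HeightOneSpectrum (NumberField.RingOfIntegers F)) (hv : ((ℓ : ℕ) : NumberField.RingOfIntegers F) ∈ v.asIdeal)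
    (τ : v.adicCompletion F →+* PadicAlgCl ℓ), Continuous τ → ∀ w : ℤ,
      (ρ.labelledHodgeTateWeightsAt v (Literature.NumberTheory.PAdicHodge.fontainePstAdicCompletion v ℓ hv).algebra
        (Literature.NumberTheory.PAdicHodge.fontainePstAdicCompletion v ℓ hv).𝔅 τ).count w ≤ k

/-- WALL Hodge–Tate type (m = 2; g10 VERBATIM). -/
def IsWallHT (ρ : Literature.NumberTheory.GaloisRepresentations.FramedGaloisRep F (PadicAlgCl ℓ) n) : Prop :=
  ¬ HodgeTateMultLE 1 ρ ∧ HodgeTateMultLE 2 ρ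

/-- **Lie-irreducible** (g2/g10 VERBATIM): irreducible on Γ_L for EVERY number field L ⊇ F. (Patrikis, *Variations on a theorem of Tate*, arXiv:1207.6724, §1). -/
def IsLieIrreducible (ρ : Literature.NumberTheory.GaloisRepresentations.FramedGaloisRep F (PadicAlgCl ℓ) n) : Prop :=
  ∀ (L : Type) [Field L] [NumberField L] [Algebra F L], (ρ.restrictField L).toGaloisRep.IsIrreducible

/-- **Potentially scalar** = finite projective image = Artin type up to twist (g2/g10 VERBATIM). (Patrikis, arXiv:1207.6724, Prop. 4.1.1). -/
def HasFiniteProjectiveImage (ρ : Literature.NumberTheory.GaloisRepresentations.FramedGaloisRep F (PadicAlgCl ℓ) n) : Prop :=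
  ∃ (L : Type) (_ : Field L) (_ : NumberField L) (_ : Algebra F L),
    ∀ σ : Field.absoluteGaloisGroup L, ∃ c : PadicAlgCl ℓ,
      ((ρ.restrictField L σ : GL (Fin n) (PadicAlgCl ℓ)) : Matrix (Fin n) (Fin n) (PadicAlgCl ℓ)) =
        c • (1 : Matrix (Fin n) (Fin n) (PadicAlgCl ℓ))

/-- **Primitive infinite monodromy** (g10 VERBATIM): Lie-irreducible and not potentially scalar. -/
def IsPrimitiveInfinite (ρ : Literature.NumberTheory.GaloisRepresentations.FramedGaloisRep F (PadicAlgCl ℓ) n) : Prop :=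
  ¬ HasFiniteProjectiveImage ρ ∧ IsLieIrreducible ρ

/-- **THE g11 DIAL — minuscule Hodge–Tate cocharacter** (NEW): at every v ∣ ℓ and every label τ the labelled Hodge–Tate weights of ρ (Fontaine's
pinned datum, as in the summit) lie in {a, a + 1} for some integer a = a_{v,τ}; equivalently ad ∘ μ_HT has weights in {−1, 0, 1} (Deligne (SV1)),
μ_HT is minuscule modulo the centre, the τ-Hodge structure is of weight-one / Shimura type.
[corpus:book:editornd-shimura-varieties, Genestier–Ngô ch., p. 72 («SD1 ⟹ weights {−1,0,1}: minuscule»), p. 94]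
[cite: Humphreys1972, §13 Ex. 13 (minuscule weights; tree `Literature.AlgebraicGeometry.Motives.IsMinusculeWeight`)] -/
def IsHTMinuscule (ρ : Literature.NumberTheory.GaloisRepresentations.FramedGaloisRep F (PadicAlgCl ℓ) n) : Prop :=
  ∀ (v : IsDedekindDomain.HeightOneSpectrum (NumberField.RingOfIntegers F)) (hv : ((ℓ : ℕ) : NumberField.RingOfIntegers F) ∈ v.asIdeal)
    (τ : v.adicCompletion F →+* PadicAlgCl ℓ), Continuous τ → ∃ a : ℤ, ∀ w ∈
      (ρ.labelledHodgeTateWeightsAt v (Literature.NumberTheory.PAdicHodge.fontainePstAdicCompletion v ℓ hv).algebra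
        (Literature.NumberTheory.PAdicHodge.fontainePstAdicCompletion v ℓ hv).𝔅 τ), w = a ∨ w = a + 1

end Vocabulary

/-! ## 2. Certificates on the dial: a minuscule multiset with all multiplicities ≤ 2 has at most four elements (so, ON PAPER where `card HT_τ = n`,
minuscule ∧ wall forces n ≤ 4 and the wall shapes are {a,a}, {a,a,a+1}, {a,a+1,a+1}, {a,a,a+1,a+1}); the rank cases are exhaustive and exclusive. -/

section Certificates

/-- a multiset of integers supported on {a, a+1} with every multiplicity ≤ 2 has cardinality ≤ 4. -/
theorem card_le_four_of_minuscule_wall (s : Multiset ℤ) (a : ℤ) (hs : ∀ w ∈ s, w = a ∨ w = a + 1) (hc : ∀ w : ℤ, s.count w ≤ 2) :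
    Multiset.card s ≤ 4 := by
  classical
  have hsub : s.toFinset ⊆ ({a, a + 1} : Finset ℤ) := by
    intro w hw
    rw [Multiset.mem_toFinset] at hw
    rcases hs w hw with h | h <;> simp [h]
  calc Multiset.card s = ∑ w ∈ s.toFinset, s.count w := (Multiset.toFinset_sum_count_eq s).symm
    _ ≤ ∑ w ∈ ({a, a + 1} : Finset ℤ), s.count w := Finset.sum_le_sum_of_subset_of_nonneg hsub (fun _ _ _ => Nat.zero_le _)
    _ ≤ ∑ _w ∈ ({a, a + 1} : Finset ℤ), 2 := Finset.sum_le_sum (fun w _ => hc w)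
    _ = 4 := by rw [Finset.sum_const, Finset.card_pair (show a ≠ a + 1 by omega), smul_eq_mul]

/-- conversely the four minuscule wall shapes exist: {a,a,a+1,a+1} is supported on {a,a+1}, has all multiplicities ≤ 2, a repeated weight, and 4 elements. -/
theorem abelianSurfaceShape_minuscule_wall (a : ℤ) :
    (∀ w ∈ ({a, a, a + 1, a + 1} : Multiset ℤ), w = a ∨ w = a + 1) ∧ (∀ w : ℤ, ({a, a, a + 1, a + 1} : Multiset ℤ).count w ≤ 2) ∧
      ¬ (∀ w : ℤ, ({a, a, a + 1, a + 1} : Multiset ℤ).count w ≤ 1) ∧ Multiset.card ({a, a, a + 1, a + 1} : Multiset ℤ) = 4 := by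
  classical
  refine ⟨fun w hw => by simpa [or_assoc] using hw, fun w => ?_, fun h => ?_, by simp⟩
  · by_cases h1 : w = a
    · subst h1; simp [show w ≠ w + 1 by omega]
    · by_cases h2 : w = a + 1
      · subst h2; simp [h1]
      · simp [h1, h2]
  · have := h a
    simp [show a ≠ a + 1 by omega] at this

/-- a non-minuscule wall shape of rank 4 (residual side, gap-free!): {a, a, a+1, a+2} is NOT supported on any {b, b+1}. -/
theorem siegelKTwoShape_not_minuscule (a : ℤ) : ¬ ∃ b : ℤ, ∀ w ∈ ({a, a, a + 1, a + 2} : Multiset ℤ), w = b ∨ w = b + 1 := by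
  rintro ⟨b, hb⟩
  have h0 := hb a (by simp)
  have h2 := hb (a + 2) (by simp)
  omega

/-- the rank cases of the cut are exhaustive … -/
theorem rank_cases (n : ℕ) : (n ≤ 2 ∨ n = 3 ∨ n = 4) ∨ ¬ n ≤ 4 := by omega

/-- … and exclusive. -/
theorem rank_cases_exclusive (n : ℕ) : ¬ (n ≤ 2 ∧ n = 3) ∧ ¬ (n ≤ 2 ∧ n = 4) ∧ ¬ (n = 3 ∧ n = 4) ∧
    ¬ ((n ≤ 2 ∨ n = 3 ∨ n = 4) ∧ ¬ n ≤ 4) := by omega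

end Certificates

/-! ## 3. Clause (B) restricted to a population, the IH (g10 VERBATIM structured forms) -/

section Clause

variable {n : ℕ} {F : Type} [Field F] [NumberField F]

/-- Clause (A) of the summit for the `π` satisfying `P` (g0/g10 VERBATIM; only used to state the IH). -/
def AutomorphicToGaloisOn (Rd : Summit.Langlands.ReciprocityData F) (hcpt : Literature.NumberTheory.Automorphic.isCompact_glFiniteIntegralLevel n F)
    (P : Literature.NumberTheory.Automorphic.AutomorphicRepData (Literature.NumberTheory.Automorphic.AutomorphyDatum.gl n F hcpt) → Prop) : Prop :=
  ∀ π : Literature.NumberTheory.Automorphic.CuspidalAutomorphicRepData n F hcpt, π.1.IsLAlgebraic → P π.1 →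
    ∀ (ℓ : ℕ) [Fact ℓ.Prime] (ι : PadicAlgCl ℓ ≃+* ℂ),
      ∃ ρ : Literature.NumberTheory.GaloisRepresentations.FramedGaloisRep F (PadicAlgCl ℓ) n,
        ρ.toGaloisRep.IsIrreducible ∧ Summit.Langlands.IsGeometricFramed Rd ρ ∧ Summit.Langlands.Corresponds Rd ι π.1 ρ ∧
          ∀ ρ' : Literature.NumberTheory.GaloisRepresentations.FramedGaloisRep F (PadicAlgCl ℓ) n,
            Summit.Langlands.Corresponds Rd ι π.1 ρ' → Summit.Langlands.IsConjugate ρ ρ'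

/-- Clause (B) of the summit (`Summit.Langlands.GaloisToAutomorphic`, verbatim) for the `ρ` satisfying `Q`. -/
def GaloisToAutomorphicOn (Rd : Summit.Langlands.ReciprocityData F) (hcpt : Literature.NumberTheory.Automorphic.isCompact_glFiniteIntegralLevel n F)
    (Q : ∀ (ℓ : ℕ) [Fact ℓ.Prime], Literature.NumberTheory.GaloisRepresentations.FramedGaloisRep F (PadicAlgCl ℓ) n → Prop) : Prop :=
  ∀ (ℓ : ℕ) [Fact ℓ.Prime] (ι : PadicAlgCl ℓ ≃+* ℂ) (ρ : Literature.NumberTheory.GaloisRepresentations.FramedGaloisRep F (PadicAlgCl ℓ) n),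
    ρ.toGaloisRep.IsIrreducible → Summit.Langlands.IsGeometricFramed Rd ρ → Q ℓ ρ →
      ∃ π : Literature.NumberTheory.Automorphic.CuspidalAutomorphicRepData n F hcpt, π.1.IsLAlgebraic ∧ Summit.Langlands.Corresponds Rd ι π.1 ρ

/-- weight multiplicity ≤ k on the automorphic side (g0/g10 VERBATIM; only used to state the IH). -/
def WeightMultLE (k : ℕ) {hcpt : Literature.NumberTheory.Automorphic.isCompact_glFiniteIntegralLevel n F}
    (π : Literature.NumberTheory.Automorphic.AutomorphicRepData (Literature.NumberTheory.Automorphic.AutomorphyDatum.gl n F hcpt)) : Prop :=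
  ∃ T : Literature.NumberTheory.Automorphic.InfinityType F n, π.HasInfinityType T ∧
    ∀ (σ : F →+* ℂ) (a : ℂ), ((T σ).map Literature.NumberTheory.Automorphic.ArchWeight.a).count a ≤ k

end Clause

/-- «multiplicity-≤-2 reciprocity below rank n» (g10 `MultTwoReciprocityBelow` VERBATIM) — the IH every cell carries. -/
def MultTwoReciprocityBelow (n : ℕ) : Prop :=
  ∀ (m : ℕ), m < n → 0 < m → ∀ (L : Type) [Field L] [NumberField L] (RdL : Summit.Langlands.ReciprocityData L)
    (hcptL : Literature.NumberTheory.Automorphic.isCompact_glFiniteIntegralLevel m L),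
      AutomorphicToGaloisOn RdL hcptL (fun π => WeightMultLE 2 π) ∧ GaloisToAutomorphicOn RdL hcptL (fun _ _ ρ => HodgeTateMultLE 2 ρ)

/-! ## 4. The TARGET of record in structured form — certified `Iff.rfl` against the TREE declaration (identity of vocabulary and text) -/

/-- The target W_Prim in structured form: `Iff.rfl` against the TREE declaration (identity of vocabulary and text). -/
theorem target_iff : Summit.Langlands.Langlands.Theses.WeightMultiplicitySplit.WallLieIrreducibleAutomorphy ↔
    (∀ (F : Type) [Field F] [NumberField F] (Rd : Summit.Langlands.ReciprocityData F) (n : ℕ), 0 < n →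
      ∀ hcpt : Literature.NumberTheory.Automorphic.isCompact_glFiniteIntegralLevel n F,
        MultTwoReciprocityBelow n → GaloisToAutomorphicOn Rd hcpt (fun _ _ ρ => IsWallHT ρ ∧ IsPrimitiveInfinite ρ)) := Iff.rfl

/-- the target's text VERBATIM (what the kit's statements.json / the probes compare against). -/
theorem target_text_iff : Summit.Langlands.Langlands.Theses.WeightMultiplicitySplit.WallLieIrreducibleAutomorphy ↔ ∀ (F : Type) [Field F] [NumberField F] (Rd : Summit.Langlands.ReciprocityData F) (n : ℕ), 0 < n → ∀ hcpt : Literature.NumberTheory.Automorphic.isCompact_glFiniteIntegralLevel n F, (∀ (m : ℕ), m < n → 0 < m → ∀ (L : Type) [Field L] [NumberField L] (RdL : Summit.Langlands.ReciprocityData L) (hcptL : Literature.NumberTheory.Automorphic.isCompact_glFiniteIntegralLevel m L), (∀ π : Literature.NumberTheory.Automorphic.CuspidalAutomorphicRepData m L hcptL, π.1.IsLAlgebraic → (∃ T : Literature.NumberTheory.Automorphic.InfinityType L m, π.1.HasInfinityType T ∧ ∀ (σ : L →+* ℂ) (a : ℂ), ((T σ).map Literature.NumberTheory.Automorphic.ArchWeight.a).count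 a ≤ 2) → ∀ (ℓ : ℕ) [Fact ℓ.Prime] (ι : PadicAlgCl ℓ ≃+* ℂ), ∃ ρ : Literature.NumberTheory.GaloisRepresentations.FramedGaloisRep L (PadicAlgCl ℓ) m, ρ.toGaloisRep.IsIrreducible ∧ Summit.Langlands.IsGeometricFramed RdL ρ ∧ Summit.Langlands.Corresponds RdL ι π.1 ρ ∧ ∀ ρ' : Literature.NumberTheory.GaloisRepresentations.FramedGaloisRep L (PadicAlgCl ℓ) m, Summit.Langlands.Corresponds RdL ι π.1 ρ' → Summit.Langlands.IsConjugate ρ ρ') ∧ (∀ (ℓ : ℕ) [Fact ℓ.Prime] (ι : PadicAlgCl ℓ ≃+* ℂ) (ρ : Literature.NumberTheory.GaloisRepresentations.FramedGaloisRep L (PadicAlgCl ℓ) m), ρ.toGaloisRep.IsIrreducible → Summit.Langlands.IsGeometricFramed RdL ρ → (∀ (v : IsDedekindDomain.HeightOneSpectrum (NumberField.RingOfIntegers L)) (hv : ((ℓ : ℕ) : NumberField.RingOfIntegers L) ∈ v.asIdeal) (τ : v.adicCompletion L →+* PadicAlgCl ℓ), Continuous τ → ∀ w : ℤ, (ρ.labelledHodgeTateWeightsAt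 v (Literature.NumberTheory.PAdicHodge.fontainePstAdicCompletion v ℓ hv).algebra (Literature.NumberTheory.PAdicHodge.fontainePstAdicCompletion v ℓ hv).𝔅 τ).count w ≤ 2) → ∃ π : Literature.NumberTheory.Automorphic.CuspidalAutomorphicRepData m L hcptL, π.1.IsLAlgebraic ∧ Summit.Langlands.Corresponds RdL ι π.1 ρ)) → (∀ (ℓ : ℕ) [Fact ℓ.Prime] (ι : PadicAlgCl ℓ ≃+* ℂ) (ρ : Literature.NumberTheory.GaloisRepresentations.FramedGaloisRep F (PadicAlgCl ℓ) n), ρ.toGaloisRep.IsIrreducible → Summit.Langlands.IsGeometricFramed Rd ρ → ((¬ (∀ (v : IsDedekindDomain.HeightOneSpectrum (NumberField.RingOfIntegers F)) (hv : ((ℓ : ℕ) : NumberField.RingOfIntegers F) ∈ v.asIdeal) (τ : v.adicCompletion F →+* PadicAlgCl ℓ), Continuous τ → ∀ w : ℤ, (ρ.labelledHodgeTateWeightsAt v (Literature.NumberTheory.PAdicHodge.fontainePstAdicCompletion v ℓ hv).algebra (Literature.NumberTheory.PAdicHodge.fontainePstAdicCompletion v ℓ hv).𝔅 τ).count w ≤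 1) ∧ (∀ (v : IsDedekindDomain.HeightOneSpectrum (NumberField.RingOfIntegers F)) (hv : ((ℓ : ℕ) : NumberField.RingOfIntegers F) ∈ v.asIdeal) (τ : v.adicCompletion F →+* PadicAlgCl ℓ), Continuous τ → ∀ w : ℤ, (ρ.labelledHodgeTateWeightsAt v (Literature.NumberTheory.PAdicHodge.fontainePstAdicCompletion v ℓ hv).algebra (Literature.NumberTheory.PAdicHodge.fontainePstAdicCompletion v ℓ hv).𝔅 τ).count w ≤ 2)) ∧ (¬ (∃ (L : Type) (_ : Field L) (_ : NumberField L) (_ : Algebra F L), ∀ σ : Field.absoluteGaloisGroup L, ∃ c : PadicAlgCl ℓ, ((ρ.restrictField L σ : GL (Fin n) (PadicAlgCl ℓ)) : Matrix (Fin n) (Fin n) (PadicAlgCl ℓ)) = c • (1 : Matrix (Fin n) (Fin n) (PadicAlgCl ℓ))) ∧ (∀ (L : Type) [Field L] [NumberField L] [Algebra F L], (ρ.restrictField L).toGaloisRep.IsIrreducible))) → ∃ π : Literature.NumberTheory.Automorphic.CuspidalAutomorphicRepData n F hcpt, π.1.IsLAlgebraic ∧ Summit.Langlands.Corresponds Rd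 ι π.1 ρ) := Iff.rfl

/-! ## 5. THE FOUR CELLS + THE FRAME (the items; inlined one-liners over existing tree declarations = childroute.items.json `statement` VERBATIM) -/

/-- MIN2 · crux · WEAKER · EMPTY-BY-THEOREM on the odd totally-real sector («vanishing in disguise»), dark elsewhere.  GIVEN multiplicity-≤-2 reciprocity
below rank n, clause (B) for the wall-type Lie-irreducible non-potentially-scalar ρ of rank n ≤ 2 whose Hodge–Tate cocharacter is MINUSCULE at every
label: weight-one Hodge type {a,a} / {a,a+1} per label with a repeated weight somewhere and INFINITE primitive monodromy. -/
def MinusculeWallRankTwoAutomorphy : Prop :=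
  ∀ (F : Type) [Field F] [NumberField F] (Rd : Summit.Langlands.ReciprocityData F) (n : ℕ), 0 < n → ∀ hcpt : Literature.NumberTheory.Automorphic.isCompact_glFiniteIntegralLevel n F, (∀ (m : ℕ), m < n → 0 < m → ∀ (L : Type) [Field L] [NumberField L] (RdL : Summit.Langlands.ReciprocityData L) (hcptL : Literature.NumberTheory.Automorphic.isCompact_glFiniteIntegralLevel m L), (∀ π : Literature.NumberTheory.Automorphic.CuspidalAutomorphicRepData m L hcptL, π.1.IsLAlgebraic → (∃ T : Literature.NumberTheory.Automorphic.InfinityType L m, π.1.HasInfinityType T ∧ ∀ (σ : L →+* ℂ) (a : ℂ), ((T σ).map Literature.NumberTheory.Automorphic.ArchWeight.a).count a ≤ 2) → ∀ (ℓ : ℕ) [Fact ℓ.Prime] (ι : PadicAlgCl ℓ ≃+* ℂ), ∃ ρ : Literature.NumberTheory.GaloisRepresentations.FramedGaloisRep L (PadicAlgCl ℓ) m, ρ.toGaloisRep.IsIrreducible ∧ Summit.Langlands.IsGeometricFramed RdL ρ ∧ Summit.Langlands.Corresponds RdL ι π.1 ρ ∧ ∀ ρ' : Literature.NumberTheory.GaloisRepresentations.FramedGaloisRep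 L (PadicAlgCl ℓ) m, Summit.Langlands.Corresponds RdL ι π.1 ρ' → Summit.Langlands.IsConjugate ρ ρ') ∧ (∀ (ℓ : ℕ) [Fact ℓ.Prime] (ι : PadicAlgCl ℓ ≃+* ℂ) (ρ : Literature.NumberTheory.GaloisRepresentations.FramedGaloisRep L (PadicAlgCl ℓ) m), ρ.toGaloisRep.IsIrreducible → Summit.Langlands.IsGeometricFramed RdL ρ → (∀ (v : IsDedekindDomain.HeightOneSpectrum (NumberField.RingOfIntegers L)) (hv : ((ℓ : ℕ) : NumberField.RingOfIntegers L) ∈ v.asIdeal) (τ : v.adicCompletion L →+* PadicAlgCl ℓ), Continuous τ → ∀ w : ℤ, (ρ.labelledHodgeTateWeightsAt v (Literature.NumberTheory.PAdicHodge.fontainePstAdicCompletion v ℓ hv).algebra (Literature.NumberTheory.PAdicHodge.fontainePstAdicCompletion v ℓ hv).𝔅 τ).count w ≤ 2) → ∃ π : Literature.NumberTheory.Automorphic.CuspidalAutomorphicRepData m L hcptL, π.1.IsLAlgebraic ∧ Summit.Langlands.Corresponds RdL ι π.1 ρ)) → (∀ (ℓ : ℕ) [Fact ℓ.Prime] (ι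 : PadicAlgCl ℓ ≃+* ℂ) (ρ : Literature.NumberTheory.GaloisRepresentations.FramedGaloisRep F (PadicAlgCl ℓ) n), ρ.toGaloisRep.IsIrreducible → Summit.Langlands.IsGeometricFramed Rd ρ → (((¬ (∀ (v : IsDedekindDomain.HeightOneSpectrum (NumberField.RingOfIntegers F)) (hv : ((ℓ : ℕ) : NumberField.RingOfIntegers F) ∈ v.asIdeal) (τ : v.adicCompletion F →+* PadicAlgCl ℓ), Continuous τ → ∀ w : ℤ, (ρ.labelledHodgeTateWeightsAt v (Literature.NumberTheory.PAdicHodge.fontainePstAdicCompletion v ℓ hv).algebra (Literature.NumberTheory.PAdicHodge.fontainePstAdicCompletion v ℓ hv).𝔅 τ).count w ≤ 1) ∧ (∀ (v : IsDedekindDomain.HeightOneSpectrum (NumberField.RingOfIntegers F)) (hv : ((ℓ : ℕ) : NumberField.RingOfIntegers F) ∈ v.asIdeal) (τ : v.adicCompletion F →+* PadicAlgCl ℓ), Continuous τ → ∀ w : ℤ, (ρ.labelledHodgeTateWeightsAt v (Literature.NumberTheory.PAdicHodge.fontainePstAdicCompletion v ℓ hv).algebra (Literature.NumberTheory.PAdicHodge.fontainePstAdicCompletion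 v ℓ hv).𝔅 τ).count w ≤ 2)) ∧ (¬ (∃ (L : Type) (_ : Field L) (_ : NumberField L) (_ : Algebra F L), ∀ σ : Field.absoluteGaloisGroup L, ∃ c : PadicAlgCl ℓ, ((ρ.restrictField L σ : GL (Fin n) (PadicAlgCl ℓ)) : Matrix (Fin n) (Fin n) (PadicAlgCl ℓ)) = c • (1 : Matrix (Fin n) (Fin n) (PadicAlgCl ℓ))) ∧ (∀ (L : Type) [Field L] [NumberField L] [Algebra F L], (ρ.restrictField L).toGaloisRep.IsIrreducible))) ∧ ((∀ (v : IsDedekindDomain.HeightOneSpectrum (NumberField.RingOfIntegers F)) (hv : ((ℓ : ℕ) : NumberField.RingOfIntegers F) ∈ v.asIdeal) (τ : v.adicCompletion F →+* PadicAlgCl ℓ), Continuous τ → ∃ a : ℤ, ∀ w ∈ (ρ.labelledHodgeTateWeightsAt v (Literature.NumberTheory.PAdicHodge.fontainePstAdicCompletion v ℓ hv).algebra (Literature.NumberTheory.PAdicHodge.fontainePstAdicCompletion v ℓ hv).𝔅 τ), w = a ∨ w = a + 1) ∧ n ≤ 2)) → ∃ π : Literature.NumberTheory.Automorphic.CuspidalAutomorphicRepData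 n F hcpt, π.1.IsLAlgebraic ∧ Summit.Langlands.Corresponds Rd ι π.1 ρ)

/-- MIN3 · crux · WEAKER · IDEA-NEEDED ((B) for Picard type; (A)-side instruments only).  GIVEN the IH, clause (B) for the wall-type primitive ρ of rank 3
with MINUSCULE Hodge–Tate cocharacter: Picard / U(2,1) type {a,a,a+1} or {a,a+1,a+1} at every label. -/
def MinusculeWallRankThreeAutomorphy : Prop :=
  ∀ (F : Type) [Field F] [NumberField F] (Rd : Summit.Langlands.ReciprocityData F) (n : ℕ), 0 < n → ∀ hcpt : Literature.NumberTheory.Automorphic.isCompact_glFiniteIntegralLevel n F, (∀ (m : ℕ), m < n → 0 < m → ∀ (L : Type) [Field L] [NumberField L] (RdL : Summit.Langlands.ReciprocityData L) (hcptL : Literature.NumberTheory.Automorphic.isCompact_glFiniteIntegralLevel m L), (∀ π : Literature.NumberTheory.Automorphic.CuspidalAutomorphicRepData m L hcptL, π.1.IsLAlgebraic → (∃ T : Literature.NumberTheory.Automorphic.InfinityType L m, π.1.HasInfinityType T ∧ ∀ (σ : L →+* ℂ) (a : ℂ), ((T σ).map Literature.NumberTheory.Automorphic.ArchWeight.a).count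 a ≤ 2) → ∀ (ℓ : ℕ) [Fact ℓ.Prime] (ι : PadicAlgCl ℓ ≃+* ℂ), ∃ ρ : Literature.NumberTheory.GaloisRepresentations.FramedGaloisRep L (PadicAlgCl ℓ) m, ρ.toGaloisRep.IsIrreducible ∧ Summit.Langlands.IsGeometricFramed RdL ρ ∧ Summit.Langlands.Corresponds RdL ι π.1 ρ ∧ ∀ ρ' : Literature.NumberTheory.GaloisRepresentations.FramedGaloisRep L (PadicAlgCl ℓ) m, Summit.Langlands.Corresponds RdL ι π.1 ρ' → Summit.Langlands.IsConjugate ρ ρ') ∧ (∀ (ℓ : ℕ) [Fact ℓ.Prime] (ι : PadicAlgCl ℓ ≃+* ℂ) (ρ : Literature.NumberTheory.GaloisRepresentations.FramedGaloisRep L (PadicAlgCl ℓ) m), ρ.toGaloisRep.IsIrreducible → Summit.Langlands.IsGeometricFramed RdL ρ → (∀ (v : IsDedekindDomain.HeightOneSpectrum (NumberField.RingOfIntegers L)) (hv : ((ℓ : ℕ) : NumberField.RingOfIntegers L) ∈ v.asIdeal) (τ : v.adicCompletion L →+* PadicAlgCl ℓ), Continuous τ → ∀ w : ℤ, (ρ.labelledHodgeTateWeightsAt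 v (Literature.NumberTheory.PAdicHodge.fontainePstAdicCompletion v ℓ hv).algebra (Literature.NumberTheory.PAdicHodge.fontainePstAdicCompletion v ℓ hv).𝔅 τ).count w ≤ 2) → ∃ π : Literature.NumberTheory.Automorphic.CuspidalAutomorphicRepData m L hcptL, π.1.IsLAlgebraic ∧ Summit.Langlands.Corresponds RdL ι π.1 ρ)) → (∀ (ℓ : ℕ) [Fact ℓ.Prime] (ι : PadicAlgCl ℓ ≃+* ℂ) (ρ : Literature.NumberTheory.GaloisRepresentations.FramedGaloisRep F (PadicAlgCl ℓ) n), ρ.toGaloisRep.IsIrreducible → Summit.Langlands.IsGeometricFramed Rd ρ → (((¬ (∀ (v : IsDedekindDomain.HeightOneSpectrum (NumberField.RingOfIntegers F)) (hv : ((ℓ : ℕ) : NumberField.RingOfIntegers F) ∈ v.asIdeal) (τ : v.adicCompletion F →+* PadicAlgCl ℓ), Continuous τ → ∀ w : ℤ, (ρ.labelledHodgeTateWeightsAt v (Literature.NumberTheory.PAdicHodge.fontainePstAdicCompletion v ℓ hv).algebra (Literature.NumberTheory.PAdicHodge.fontainePstAdicCompletion v ℓ hv).𝔅 τ).count w ≤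 1) ∧ (∀ (v : IsDedekindDomain.HeightOneSpectrum (NumberField.RingOfIntegers F)) (hv : ((ℓ : ℕ) : NumberField.RingOfIntegers F) ∈ v.asIdeal) (τ : v.adicCompletion F →+* PadicAlgCl ℓ), Continuous τ → ∀ w : ℤ, (ρ.labelledHodgeTateWeightsAt v (Literature.NumberTheory.PAdicHodge.fontainePstAdicCompletion v ℓ hv).algebra (Literature.NumberTheory.PAdicHodge.fontainePstAdicCompletion v ℓ hv).𝔅 τ).count w ≤ 2)) ∧ (¬ (∃ (L : Type) (_ : Field L) (_ : NumberField L) (_ : Algebra F L), ∀ σ : Field.absoluteGaloisGroup L, ∃ c : PadicAlgCl ℓ, ((ρ.restrictField L σ : GL (Fin n) (PadicAlgCl ℓ)) : Matrix (Fin n) (Fin n) (PadicAlgCl ℓ)) = c • (1 : Matrix (Fin n) (Fin n) (PadicAlgCl ℓ))) ∧ (∀ (L : Type) [Field L] [NumberField L] [Algebra F L], (ρ.restrictField L).toGaloisRep.IsIrreducible))) ∧ ((∀ (v : IsDedekindDomain.HeightOneSpectrum (NumberField.RingOfIntegers F)) (hv : ((ℓ : ℕ) : NumberField.RingOfIntegers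 F) ∈ v.asIdeal) (τ : v.adicCompletion F →+* PadicAlgCl ℓ), Continuous τ → ∃ a : ℤ, ∀ w ∈ (ρ.labelledHodgeTateWeightsAt v (Literature.NumberTheory.PAdicHodge.fontainePstAdicCompletion v ℓ hv).algebra (Literature.NumberTheory.PAdicHodge.fontainePstAdicCompletion v ℓ hv).𝔅 τ), w = a ∨ w = a + 1) ∧ n = 3)) → ∃ π : Literature.NumberTheory.Automorphic.CuspidalAutomorphicRepData n F hcpt, π.1.IsLAlgebraic ∧ Summit.Langlands.Corresponds Rd ι π.1 ρ)

/-- MIN4 · crux · WEAKER · ATTACKABLE-BY-ENGINE (BCGP 2021 potential automorphy Thm 1.1.3 = tree fact `bcgp2021_potentiallyAutomorphic_abelianSurface`;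
BCGP 2025 modularity = tree facts `bcgp2025_modThreeSurjective_modular_abelianSurface`, `bcgp_residuallyA5b_modular_abelianSurface`, …) — the
ATTACKED CONJUNCT.  GIVEN the IH, clause (B) for the wall-type primitive ρ of rank 4 with MINUSCULE Hodge–Tate cocharacter: abelian-surface type
{a,a,a+1,a+1} at every label (symplectic, unitary U(2,2) and unpolarised alike, every F). -/
def MinusculeWallRankFourAutomorphy : Prop :=
  ∀ (F : Type) [Field F] [NumberField F] (Rd : Summit.Langlands.ReciprocityData F) (n : ℕ), 0 < n → ∀ hcpt : Literature.NumberTheory.Automorphic.isCompact_glFiniteIntegralLevel n F, (∀ (m : ℕ), m < n → 0 < m → ∀ (L : Type) [Field L] [NumberField L] (RdL : Summit.Langlands.ReciprocityData L) (hcptL : Literature.NumberTheory.Automorphic.isCompact_glFiniteIntegralLevel m L), (∀ π : Literature.NumberTheory.Automorphic.CuspidalAutomorphicRepData m L hcptL, π.1.IsLAlgebraic → (∃ T : Literature.NumberTheory.Automorphic.InfinityType L m, π.1.HasInfinityType T ∧ ∀ (σ : L →+* ℂ) (a : ℂ), ((T σ).map Literature.NumberTheory.Automorphic.ArchWeight.a).count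 a ≤ 2) → ∀ (ℓ : ℕ) [Fact ℓ.Prime] (ι : PadicAlgCl ℓ ≃+* ℂ), ∃ ρ : Literature.NumberTheory.GaloisRepresentations.FramedGaloisRep L (PadicAlgCl ℓ) m, ρ.toGaloisRep.IsIrreducible ∧ Summit.Langlands.IsGeometricFramed RdL ρ ∧ Summit.Langlands.Corresponds RdL ι π.1 ρ ∧ ∀ ρ' : Literature.NumberTheory.GaloisRepresentations.FramedGaloisRep L (PadicAlgCl ℓ) m, Summit.Langlands.Corresponds RdL ι π.1 ρ' → Summit.Langlands.IsConjugate ρ ρ') ∧ (∀ (ℓ : ℕ) [Fact ℓ.Prime] (ι : PadicAlgCl ℓ ≃+* ℂ) (ρ : Literature.NumberTheory.GaloisRepresentations.FramedGaloisRep L (PadicAlgCl ℓ) m), ρ.toGaloisRep.IsIrreducible → Summit.Langlands.IsGeometricFramed RdL ρ → (∀ (v : IsDedekindDomain.HeightOneSpectrum (NumberField.RingOfIntegers L)) (hv : ((ℓ : ℕ) : NumberField.RingOfIntegers L) ∈ v.asIdeal) (τ : v.adicCompletion L →+* PadicAlgCl ℓ), Continuous τ → ∀ w : ℤ, (ρ.labelledHodgeTateWeightsAt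 v (Literature.NumberTheory.PAdicHodge.fontainePstAdicCompletion v ℓ hv).algebra (Literature.NumberTheory.PAdicHodge.fontainePstAdicCompletion v ℓ hv).𝔅 τ).count w ≤ 2) → ∃ π : Literature.NumberTheory.Automorphic.CuspidalAutomorphicRepData m L hcptL, π.1.IsLAlgebraic ∧ Summit.Langlands.Corresponds RdL ι π.1 ρ)) → (∀ (ℓ : ℕ) [Fact ℓ.Prime] (ι : PadicAlgCl ℓ ≃+* ℂ) (ρ : Literature.NumberTheory.GaloisRepresentations.FramedGaloisRep F (PadicAlgCl ℓ) n), ρ.toGaloisRep.IsIrreducible → Summit.Langlands.IsGeometricFramed Rd ρ → (((¬ (∀ (v : IsDedekindDomain.HeightOneSpectrum (NumberField.RingOfIntegers F)) (hv : ((ℓ : ℕ) : NumberField.RingOfIntegers F) ∈ v.asIdeal) (τ : v.adicCompletion F →+* PadicAlgCl ℓ), Continuous τ → ∀ w : ℤ, (ρ.labelledHodgeTateWeightsAt v (Literature.NumberTheory.PAdicHodge.fontainePstAdicCompletion v ℓ hv).algebra (Literature.NumberTheory.PAdicHodge.fontainePstAdicCompletion v ℓ hv).𝔅 τ).count w ≤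 1) ∧ (∀ (v : IsDedekindDomain.HeightOneSpectrum (NumberField.RingOfIntegers F)) (hv : ((ℓ : ℕ) : NumberField.RingOfIntegers F) ∈ v.asIdeal) (τ : v.adicCompletion F →+* PadicAlgCl ℓ), Continuous τ → ∀ w : ℤ, (ρ.labelledHodgeTateWeightsAt v (Literature.NumberTheory.PAdicHodge.fontainePstAdicCompletion v ℓ hv).algebra (Literature.NumberTheory.PAdicHodge.fontainePstAdicCompletion v ℓ hv).𝔅 τ).count w ≤ 2)) ∧ (¬ (∃ (L : Type) (_ : Field L) (_ : NumberField L) (_ : Algebra F L), ∀ σ : Field.absoluteGaloisGroup L, ∃ c : PadicAlgCl ℓ, ((ρ.restrictField L σ : GL (Fin n) (PadicAlgCl ℓ)) : Matrix (Fin n) (Fin n) (PadicAlgCl ℓ)) = c • (1 : Matrix (Fin n) (Fin n) (PadicAlgCl ℓ))) ∧ (∀ (L : Type) [Field L] [NumberField L] [Algebra F L], (ρ.restrictField L).toGaloisRep.IsIrreducible))) ∧ ((∀ (v : IsDedekindDomain.HeightOneSpectrum (NumberField.RingOfIntegers F)) (hv : ((ℓ : ℕ) : NumberField.RingOfIntegers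 F) ∈ v.asIdeal) (τ : v.adicCompletion F →+* PadicAlgCl ℓ), Continuous τ → ∃ a : ℤ, ∀ w ∈ (ρ.labelledHodgeTateWeightsAt v (Literature.NumberTheory.PAdicHodge.fontainePstAdicCompletion v ℓ hv).algebra (Literature.NumberTheory.PAdicHodge.fontainePstAdicCompletion v ℓ hv).𝔅 τ), w = a ∨ w = a + 1) ∧ n = 4)) → ∃ π : Literature.NumberTheory.Automorphic.CuspidalAutomorphicRepData n F hcpt, π.1.IsLAlgebraic ∧ Summit.Langlands.Corresponds Rd ι π.1 ρ)

/-- R · crux · WEAKER · BARRIER (NonRegularWeight head-on; Griffiths-rigid: no family witness, no Shimura-type moduli) · IDEA-NEEDED = DECLARED RESIDUAL.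
GIVEN the IH, clause (B) for the wall-type primitive ρ that are NOT (minuscule of rank ≤ 4): Hodge length ≥ 2 at some label (partial weight one
{a,a}|{b,b+2k}, (k,2)-Siegel type {a,a,a+k-1,a+k-1} k ≥ 3, non-minuscule U(2,1) {a,a,a+k}, every wall type of rank ≥ 5, …) or the paper-empty
phantom «minuscule of rank ≥ 5». -/
def NonMinusculeWallAutomorphy : Prop :=
  ∀ (F : Type) [Field F] [NumberField F] (Rd : Summit.Langlands.ReciprocityData F) (n : ℕ), 0 < n → ∀ hcpt : Literature.NumberTheory.Automorphic.isCompact_glFiniteIntegralLevel n F, (∀ (m : ℕ), m < n → 0 < m → ∀ (L : Type) [Field L] [NumberField L] (RdL : Summit.Langlands.ReciprocityData L) (hcptL : Literature.NumberTheory.Automorphic.isCompact_glFiniteIntegralLevel m L), (∀ π : Literature.NumberTheory.Automorphic.CuspidalAutomorphicRepData m L hcptL, π.1.IsLAlgebraic → (∃ T : Literature.NumberTheory.Automorphic.InfinityType L m, π.1.HasInfinityType T ∧ ∀ (σ : L →+* ℂ) (a : ℂ), ((T σ).map Literature.NumberTheory.Automorphic.ArchWeight.a).count a ≤ 2) → ∀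 (ℓ : ℕ) [Fact ℓ.Prime] (ι : PadicAlgCl ℓ ≃+* ℂ), ∃ ρ : Literature.NumberTheory.GaloisRepresentations.FramedGaloisRep L (PadicAlgCl ℓ) m, ρ.toGaloisRep.IsIrreducible ∧ Summit.Langlands.IsGeometricFramed RdL ρ ∧ Summit.Langlands.Corresponds RdL ι π.1 ρ ∧ ∀ ρ' : Literature.NumberTheory.GaloisRepresentations.FramedGaloisRep L (PadicAlgCl ℓ) m, Summit.Langlands.Corresponds RdL ι π.1 ρ' → Summit.Langlands.IsConjugate ρ ρ') ∧ (∀ (ℓ : ℕ) [Fact ℓ.Prime] (ι : PadicAlgCl ℓ ≃+* ℂ) (ρ : Literature.NumberTheory.GaloisRepresentations.FramedGaloisRep L (PadicAlgCl ℓ) m), ρ.toGaloisRep.IsIrreducible → Summit.Langlands.IsGeometricFramed RdL ρ → (∀ (v : IsDedekindDomain.HeightOneSpectrum (NumberField.RingOfIntegers L)) (hv : ((ℓ : ℕ) : NumberField.RingOfIntegers L) ∈ v.asIdeal) (τ : v.adicCompletion L →+* PadicAlgCl ℓ), Continuous τ → ∀ w : ℤ, (ρ.labelledHodgeTateWeightsAt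 v (Literature.NumberTheory.PAdicHodge.fontainePstAdicCompletion v ℓ hv).algebra (Literature.NumberTheory.PAdicHodge.fontainePstAdicCompletion v ℓ hv).𝔅 τ).count w ≤ 2) → ∃ π : Literature.NumberTheory.Automorphic.CuspidalAutomorphicRepData m L hcptL, π.1.IsLAlgebraic ∧ Summit.Langlands.Corresponds RdL ι π.1 ρ)) → (∀ (ℓ : ℕ) [Fact ℓ.Prime] (ι : PadicAlgCl ℓ ≃+* ℂ) (ρ : Literature.NumberTheory.GaloisRepresentations.FramedGaloisRep F (PadicAlgCl ℓ) n), ρ.toGaloisRep.IsIrreducible → Summit.Langlands.IsGeometricFramed Rd ρ → (((¬ (∀ (v : IsDedekindDomain.HeightOneSpectrum (NumberField.RingOfIntegers F)) (hv : ((ℓ : ℕ) : NumberField.RingOfIntegers F) ∈ v.asIdeal) (τ : v.adicCompletion F →+* PadicAlgCl ℓ), Continuous τ → ∀ w : ℤ, (ρ.labelledHodgeTateWeightsAt v (Literature.NumberTheory.PAdicHodge.fontainePstAdicCompletion v ℓ hv).algebra (Literature.NumberTheory.PAdicHodge.fontainePstAdicCompletion v ℓ hv).𝔅 τ).count w ≤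 1) ∧ (∀ (v : IsDedekindDomain.HeightOneSpectrum (NumberField.RingOfIntegers F)) (hv : ((ℓ : ℕ) : NumberField.RingOfIntegers F) ∈ v.asIdeal) (τ : v.adicCompletion F →+* PadicAlgCl ℓ), Continuous τ → ∀ w : ℤ, (ρ.labelledHodgeTateWeightsAt v (Literature.NumberTheory.PAdicHodge.fontainePstAdicCompletion v ℓ hv).algebra (Literature.NumberTheory.PAdicHodge.fontainePstAdicCompletion v ℓ hv).𝔅 τ).count w ≤ 2)) ∧ (¬ (∃ (L : Type) (_ : Field L) (_ : NumberField L) (_ : Algebra F L), ∀ σ : Field.absoluteGaloisGroup L, ∃ c : PadicAlgCl ℓ, ((ρ.restrictField L σ : GL (Fin n) (PadicAlgCl ℓ)) : Matrix (Fin n) (Fin n) (PadicAlgCl ℓ)) = c • (1 : Matrix (Fin n) (Fin n) (PadicAlgCl ℓ))) ∧ (∀ (L : Type) [Field L] [NumberField L] [Algebra F L], (ρ.restrictField L).toGaloisRep.IsIrreducible))) ∧ ¬ ((∀ (v : IsDedekindDomain.HeightOneSpectrum (NumberField.RingOfIntegers F)) (hv : ((ℓ : ℕ) : NumberField.RingOfIntegers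 F) ∈ v.asIdeal) (τ : v.adicCompletion F →+* PadicAlgCl ℓ), Continuous τ → ∃ a : ℤ, ∀ w ∈ (ρ.labelledHodgeTateWeightsAt v (Literature.NumberTheory.PAdicHodge.fontainePstAdicCompletion v ℓ hv).algebra (Literature.NumberTheory.PAdicHodge.fontainePstAdicCompletion v ℓ hv).𝔅 τ), w = a ∨ w = a + 1) ∧ n ≤ 4)) → ∃ π : Literature.NumberTheory.Automorphic.CuspidalAutomorphicRepData n F hcpt, π.1.IsLAlgebraic ∧ Summit.Langlands.Corresponds Rd ι π.1 ρ)

/-- FRAME · support · the HOST ROUTE below W_Prim, as one implication BY NAME: `WeightMultiplicitySplit.WallLieIrreducibleAutomorphy → Langlands`.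
Certified from the host's `closes`, the landed W-split glue and the host items G, W_A, W_Fin, W_Str, D (`frame_of_host`); trivially from Langlands. -/
def WallLieIrreducibleFrame : Prop :=
  Summit.Langlands.Langlands.Theses.WeightMultiplicitySplit.WallLieIrreducibleAutomorphy → _root_.Langlands

/-! ## 6. Identity of the items with the structured forms (`Iff.rfl` ×4) -/

/-- MIN2 is its structured box form (`Iff.rfl`). -/
theorem minusculeWallRankTwoAutomorphy_iff : MinusculeWallRankTwoAutomorphy ↔
    (∀ (F : Type) [Field F] [NumberField F] (Rd : Summit.Langlands.ReciprocityData F) (n : ℕ), 0 < n →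
      ∀ hcpt : Literature.NumberTheory.Automorphic.isCompact_glFiniteIntegralLevel n F,
        MultTwoReciprocityBelow n →
          GaloisToAutomorphicOn Rd hcpt (fun _ _ ρ => (IsWallHT ρ ∧ IsPrimitiveInfinite ρ) ∧ (IsHTMinuscule ρ ∧ n ≤ 2))) := Iff.rfl

/-- MIN3 is its structured box form (`Iff.rfl`). -/
theorem minusculeWallRankThreeAutomorphy_iff : MinusculeWallRankThreeAutomorphy ↔
    (∀ (F : Type) [Field F] [NumberField F] (Rd : Summit.Langlands.ReciprocityData F) (n : ℕ), 0 < n →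
      ∀ hcpt : Literature.NumberTheory.Automorphic.isCompact_glFiniteIntegralLevel n F,
        MultTwoReciprocityBelow n →
          GaloisToAutomorphicOn Rd hcpt (fun _ _ ρ => (IsWallHT ρ ∧ IsPrimitiveInfinite ρ) ∧ (IsHTMinuscule ρ ∧ n = 3))) := Iff.rfl

/-- MIN4 is its structured box form (`Iff.rfl`). -/
theorem minusculeWallRankFourAutomorphy_iff : MinusculeWallRankFourAutomorphy ↔
    (∀ (F : Type) [Field F] [NumberField F] (Rd : Summit.Langlands.ReciprocityData F) (n : ℕ), 0 < n →
      ∀ hcpt : Literature.NumberTheory.Automorphic.isCompact_glFiniteIntegralLevel n F,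
        MultTwoReciprocityBelow n →
          GaloisToAutomorphicOn Rd hcpt (fun _ _ ρ => (IsWallHT ρ ∧ IsPrimitiveInfinite ρ) ∧ (IsHTMinuscule ρ ∧ n = 4))) := Iff.rfl

/-- R (non-minuscule or rank ≥ 5) is its structured box form (`Iff.rfl`). -/
theorem nonMinusculeWallAutomorphy_iff : NonMinusculeWallAutomorphy ↔
    (∀ (F : Type) [Field F] [NumberField F] (Rd : Summit.Langlands.ReciprocityData F) (n : ℕ), 0 < n →
      ∀ hcpt : Literature.NumberTheory.Automorphic.isCompact_glFiniteIntegralLevel n F,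
        MultTwoReciprocityBelow n →
          GaloisToAutomorphicOn Rd hcpt (fun _ _ ρ => (IsWallHT ρ ∧ IsPrimitiveInfinite ρ) ∧ ¬ (IsHTMinuscule ρ ∧ n ≤ 4))) := Iff.rfl

/-! ## 7. KERNEL: exactness of the split, necessity, the frame, the deciding theorem -/

/-- W_Prim ⟹ each cell (every cell is W_Prim with an extra hypothesis). -/
theorem cells_of_wallLieIrreducible (hP : Summit.Langlands.Langlands.Theses.WeightMultiplicitySplit.WallLieIrreducibleAutomorphy) :
    MinusculeWallRankTwoAutomorphy ∧ MinusculeWallRankThreeAutomorphy ∧ MinusculeWallRankFourAutomorphy ∧ NonMinusculeWallAutomorphy :=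
  ⟨fun F _ _ Rd n hn hcpt hIH ℓ _ ι ρ hirr hgeo hQ => hP F Rd n hn hcpt hIH ℓ ι ρ hirr hgeo hQ.1,
   fun F _ _ Rd n hn hcpt hIH ℓ _ ι ρ hirr hgeo hQ => hP F Rd n hn hcpt hIH ℓ ι ρ hirr hgeo hQ.1,
   fun F _ _ Rd n hn hcpt hIH ℓ _ ι ρ hirr hgeo hQ => hP F Rd n hn hcpt hIH ℓ ι ρ hirr hgeo hQ.1,
   fun F _ _ Rd n hn hcpt hIH ℓ _ ι ρ hirr hgeo hQ => hP F Rd n hn hcpt hIH ℓ ι ρ hirr hgeo hQ.1⟩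

/-- the cells ⟹ W_Prim: excluded middle on the inlined dial «minuscule ∧ n ≤ 4», then `omega` on the rank (= `childroute.glue.lean`'s body). -/
theorem wallLieIrreducible_of_cells (h2 : MinusculeWallRankTwoAutomorphy) (h3 : MinusculeWallRankThreeAutomorphy)
    (h4 : MinusculeWallRankFourAutomorphy) (hR : NonMinusculeWallAutomorphy) : Summit.Langlands.Langlands.Theses.WeightMultiplicitySplit.WallLieIrreducibleAutomorphy := by
  intro F _ _ Rd n hn hcpt hIH ℓ _ ι ρ hirr hgeo hQ
  refine Classical.byCases (fun hM => ?_) (fun hM => hR F Rd n hn hcpt hIH ℓ ι ρ hirr hgeo ⟨hQ, hM⟩)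
  obtain ⟨hMin, hn4⟩ := hM
  obtain h | h | h : n ≤ 2 ∨ n = 3 ∨ n = 4 := by omega
  · exact h2 F Rd n hn hcpt hIH ℓ ι ρ hirr hgeo ⟨hQ, hMin, h⟩
  · exact h3 F Rd n hn hcpt hIH ℓ ι ρ hirr hgeo ⟨hQ, hMin, h⟩
  · exact h4 F Rd n hn hcpt hIH ℓ ι ρ hirr hgeo ⟨hQ, hMin, h⟩

/-- **EXACTNESS, mod NOTHING**: W_Prim ⟺ MIN2 ∧ MIN3 ∧ MIN4 ∧ R. -/
theorem wallLieIrreducible_iff_cells : Summit.Langlands.Langlands.Theses.WeightMultiplicitySplit.WallLieIrreducibleAutomorphy ↔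
    MinusculeWallRankTwoAutomorphy ∧ MinusculeWallRankThreeAutomorphy ∧ MinusculeWallRankFourAutomorphy ∧ NonMinusculeWallAutomorphy :=
  ⟨cells_of_wallLieIrreducible, fun h => wallLieIrreducible_of_cells h.1 h.2.1 h.2.2.1 h.2.2.2⟩

/-- the W-feed of the host split is the host's G in IH form (g10 `genericRankStep_of_generic`, re-proved over the tree decls). -/
theorem genericRankStep_of_generic (hG : Summit.Langlands.Langlands.Theses.WeightMultiplicitySplit.GenericWeightReciprocity) : Summit.Langlands.Langlands.Theses.WeightMultiplicitySplit.GenericRankStep :=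
  fun F _ _ Rd n hn hcpt _ => (hG F).2 Rd n hn hcpt

/-- **THE FRAME IS THE HOST ROUTE**: G, W_A, W_Fin, W_Str, D (host items BY NAME) ⟹ (W_Prim → Langlands), through the LANDED glue
`Theorems.WeightMultiplicitySplit_WallWeightReciprocity_of_split_proof` (item 33607, CLOSED) and the host's certified `WeightMultiplicitySplit.closes`. -/
theorem frame_of_host (hG : Summit.Langlands.Langlands.Theses.WeightMultiplicitySplit.GenericWeightReciprocity) (hA : Summit.Langlands.Langlands.Theses.WeightMultiplicitySplit.WallAutomorphicToGalois)
    (hF : Summit.Langlands.Langlands.Theses.WeightMultiplicitySplit.WallArtinTypeAutomorphy) (hS : Summit.Langlands.Langlands.Theses.WeightMultiplicitySplit.WallStructuredAutomorphy)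
    (hD : Summit.Langlands.Langlands.Theses.WeightMultiplicitySplit.DegenerateWeightReciprocity) : WallLieIrreducibleFrame := fun hP =>
  Summit.Langlands.Langlands.Theses.WeightMultiplicitySplit.closes hG
    (Summit.Langlands.Langlands.Theorems.WeightMultiplicitySplit_WallWeightReciprocity_of_split_proof hA hF hS hP (genericRankStep_of_generic hG)) hD

/-- the frame is (trivially) implied by the summit. -/
theorem frame_of_langlands (h : _root_.Langlands) : WallLieIrreducibleFrame := fun _ => h

/-- NECESSITY: the target is implied by the summit (one line over the tree's `GlobalLanglandsCorrespondenceGLn`) … -/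
theorem wallLieIrreducible_of_langlands (h : _root_.Langlands) : Summit.Langlands.Langlands.Theses.WeightMultiplicitySplit.WallLieIrreducibleAutomorphy := by
  intro F _ _ Rd n hn hcpt _ ℓ _ ι ρ hirr hgeo _
  obtain ⟨_, hB⟩ := (h F).2 Rd n hn hcpt
  exact hB ℓ ι ρ hirr hgeo

/-- … hence so is every cell (no strengthening anywhere). -/
theorem minusculeWallRankTwoAutomorphy_of_langlands (h : _root_.Langlands) : MinusculeWallRankTwoAutomorphy :=
  (cells_of_wallLieIrreducible (wallLieIrreducible_of_langlands h)).1
/-- MIN3 is implied by the summit (through W_Prim). -/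
theorem minusculeWallRankThreeAutomorphy_of_langlands (h : _root_.Langlands) : MinusculeWallRankThreeAutomorphy :=
  (cells_of_wallLieIrreducible (wallLieIrreducible_of_langlands h)).2.1
/-- MIN4 is implied by the summit (through W_Prim). -/
theorem minusculeWallRankFourAutomorphy_of_langlands (h : _root_.Langlands) : MinusculeWallRankFourAutomorphy :=
  (cells_of_wallLieIrreducible (wallLieIrreducible_of_langlands h)).2.2.1
/-- R is implied by the summit (through W_Prim). -/
theorem nonMinusculeWallAutomorphy_of_langlands (h : _root_.Langlands) : NonMinusculeWallAutomorphy :=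
  (cells_of_wallLieIrreducible (wallLieIrreducible_of_langlands h)).2.2.2

/-- **DECIDING THEOREM of the child route** (= `childroute.glue.lean` VERBATIM): the four cells and the frame ⟹ `_root_.Langlands` BY NAME. -/
theorem closes (h2 : MinusculeWallRankTwoAutomorphy) (h3 : MinusculeWallRankThreeAutomorphy) (h4 : MinusculeWallRankFourAutomorphy)
    (hR : NonMinusculeWallAutomorphy) (hF : WallLieIrreducibleFrame) : _root_.Langlands := by
  refine hF ?_
  intro F _ _ Rd n hn hcpt hIH ℓ _ ι ρ hirr hgeo hQ
  refine Classical.byCases (fun hM => ?_) (fun hM => hR F Rd n hn hcpt hIH ℓ ι ρ hirr hgeo ⟨hQ, hM⟩)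
  obtain ⟨hMin, hn4⟩ := hM
  obtain h | h | h : n ≤ 2 ∨ n = 3 ∨ n = 4 := by omega
  · exact h2 F Rd n hn hcpt hIH ℓ ι ρ hirr hgeo ⟨hQ, hMin, h⟩
  · exact h3 F Rd n hn hcpt hIH ℓ ι ρ hirr hgeo ⟨hQ, hMin, h⟩
  · exact h4 F Rd n hn hcpt hIH ℓ ι ρ hirr hgeo ⟨hQ, hMin, h⟩

/-- the deciding theorem with the HOST ITEMS in place of the frame (what the child route decides, spelled over the host route's open items). -/
theorem closes_host_shape (hG : Summit.Langlands.Langlands.Theses.WeightMultiplicitySplit.GenericWeightReciprocity) (hA : Summit.Langlands.Langlands.Theses.WeightMultiplicitySplit.WallAutomorphicToGalois)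
    (hF : Summit.Langlands.Langlands.Theses.WeightMultiplicitySplit.WallArtinTypeAutomorphy) (hS : Summit.Langlands.Langlands.Theses.WeightMultiplicitySplit.WallStructuredAutomorphy)
    (hD : Summit.Langlands.Langlands.Theses.WeightMultiplicitySplit.DegenerateWeightReciprocity)
    (h2 : MinusculeWallRankTwoAutomorphy) (h3 : MinusculeWallRankThreeAutomorphy) (h4 : MinusculeWallRankFourAutomorphy)
    (hR : NonMinusculeWallAutomorphy) : _root_.Langlands :=
  closes h2 h3 h4 hR (frame_of_host hG hA hF hS hD)

/-- **EXACTNESS of the child route, mod NOTHING**: Langlands ⟺ (MIN2 ∧ MIN3 ∧ MIN4 ∧ R) ∧ FRAME. -/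
theorem langlands_iff_pieces : _root_.Langlands ↔
    (MinusculeWallRankTwoAutomorphy ∧ MinusculeWallRankThreeAutomorphy ∧ MinusculeWallRankFourAutomorphy ∧ NonMinusculeWallAutomorphy) ∧
      WallLieIrreducibleFrame :=
  ⟨fun h => ⟨cells_of_wallLieIrreducible (wallLieIrreducible_of_langlands h), frame_of_langlands h⟩,
   fun h => closes h.1.1 h.1.2.1 h.1.2.2.1 h.1.2.2.2 h.2⟩

/-- the IH every cell carries is itself implied by the summit (no cell is vacuously true under Langlands by a false antecedent). -/
theorem multTwoReciprocityBelow_of_langlands (h : _root_.Langlands) (n : ℕ) : MultTwoReciprocityBelow n := by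
  intro m _ hm0 L _ _ RdL hcptL
  obtain ⟨hA, hB⟩ := (h L).2 RdL m hm0 hcptL
  exact ⟨fun π hπ _ ℓ _ ι => hA π hπ ℓ ι, fun ℓ _ ι ρ hirr hgeo _ => hB ℓ ι ρ hirr hgeo⟩

end Summit.Langlands.Langlands.Theorems.WeightMultiplicitySplitMinusculeHodgeType
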